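import Summits.CriticalPhenomena.CardyFormulaZ2.Theorems.CardyBoundaryCoulombGasHalfPlaneMarkDensityLawNoFreeConstant

/-!
# `HalfPlaneMarkDensityLaw` (crux stmt-CriticalPhenomena-5661), line `Sketch`, three-arc duality:
# stub `stub_threeArc_limit_of` (T1') — the three-arc limit exists and equals the wired limit

Glue.  `P_n(a,b,c,y) = P_{1/2}[[⌊an⌋,⌊bn⌋]×{0} ↔ [⌊cn⌋,⌊yn⌋]×{0} in ℤ×ℕ]` on the chamber
`a < b < c < y`, and `G` is a joint subsequential limit of `P_{θ n}` along a strictly increasing `θ`.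
Hypothesis (W1) says that for `σ, x > 0` the wired values `M ↦ G(−M, −σ, 1/M, x)` converge (to the
limit `W_G(σ,x)` of the wired kernel along `θ`).

**Claim (T1).** For `a < b < c` the three-arc limit `lim_{y → ∞} G(a,b,c,y)` exists and equals
`W_G(c − b, b − a) = lim_M G(−M, −(c−b), 1/M, b−a)`.

**Proof.** (1) `y ↦ G(a,b,c,y)` is nondecreasing on `(c, ∞)` (`Subseq.jointLimit_mono`) and bounded
by `1`, so it converges as `y → ∞` (monotone convergence `tendsto_atTop_ciSup`, after freezing the
fourth mark below `c + 1`).  (2) By reflection symmetry (`Subseq.reflect_of_jointLimit`) and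
translation invariance (`Subseq.translate_of_jointLimit`), `G(a,b,c,b+M) = G(−M, −(c−b), 0, b−a)` for
`M > c − b`, so along `y = b + M`, `M ∈ ℕ`, the three-arc limit is `lim_M G(−M, −σ, 0, x)` with
`σ = c − b`, `x = b − a`.  (3) Lowering the third mark from `1/M` to `0` grows the target arc, so
`0 ≤ G(−M,−σ,0,x) − G(−M,−σ,1/M,x) ≤ 4C(8(1/M)/σ)^α → 0` by the `δ`-move bound
(`Subseq.jointLimit_move_le` with `δ = 1/M`, gap `σ ≥ 10/M`); hence `lim_M G(−M,−σ,0,x) = W_G(σ,x)`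
and, by uniqueness of limits, the three-arc limit is `W_G(σ,x)`.
-/

noncomputable section

namespace Summit.CriticalPhenomena.CardyFormulaZ2.Cruxes.HalfPlaneMarkDensityLaw.SketchLine

open Literature.Probability.Percolation Literature.Probability.LatticeModels
open MeasureTheory Filter Set
open scoped Topology
open Summit.CriticalPhenomena.CardyFormulaZ2.Theorems.HalfPlaneMarkDensityLaw.Negative

namespace WiredDual

section Limit

variable {θ : ℕ → ℕ} {G : ℝ → ℝ → ℝ → ℝ → ℝ}
  (hG : ∀ a b c y : ℝ, a < b → b < c → c < y →
    Tendsto (fun n ↦ μ.real (openCrossing halfPlane (arcA a b (θ n))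
      (rowIcc ⌊c * (θ n : ℕ)⌋ ⌊y * (θ n : ℕ)⌋))) atTop (𝓝 (G a b c y)))
include hG

/-- **Monotone convergence in the fourth mark**: for a joint subsequential limit `G` and `a < b < c`,
`y ↦ G(a,b,c,y)` (nondecreasing on `(c,∞)`, bounded by `1`) converges as `y → ∞`, to the supremum of
its values past `c + 1`. [folklore] -/
theorem threeArc_tendsto_ciSup {a b c : ℝ} (hab : a < b) (hbc : b < c) :
    Tendsto (fun y : ℝ ↦ G a b c y) atTop (𝓝 (⨆ t : ℝ, G a b c (max t (c + 1)))) := by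
  have hmono : Monotone fun t : ℝ ↦ G a b c (max t (c + 1)) := fun s t hst ↦
    Subseq.jointLimit_mono hG (y := max s (c + 1)) (y' := max t (c + 1)) le_rfl le_rfl le_rfl
      (max_le_max_right (c + 1) hst) hab hbc (lt_of_lt_of_le (lt_add_one c) (le_max_right _ _)) hbc
  have hbdd : BddAbove (range fun t : ℝ ↦ G a b c (max t (c + 1))) := by
    refine ⟨1, ?_⟩
    rintro _ ⟨t, rfl⟩
    exact (Subseq.jointLimit_mem_Icc hG hab hbc (lt_of_lt_of_le (lt_add_one c) (le_max_right _ _))).2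
  refine (tendsto_atTop_ciSup hmono hbdd).congr' ?_
  filter_upwards [eventually_ge_atTop (c + 1)] with t ht
  simp only [max_eq_left ht]

/-- **Three arcs from four, by the lattice symmetries**: for `a < b < c` and `M > c − b`,
`G(−M, −(c−b), 0, b−a) = G(a, b, c, b+M)` (reflection `G(a,b,c,y) = G(−y,−c,−b,−a)` followed by the
translation by `b`). [folklore] -/
theorem threeArc_reflect_translate (hθ : StrictMono θ) {a b c M : ℝ} (hab : a < b) (hbc : b < c)
    (hM : c - b < M) : G (-M) (-(c - b)) 0 (b - a) = G a b c (b + M) := by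
  have h1 := Subseq.reflect_of_jointLimit hG hθ hab hbc (show c < b + M by linarith)
  have h2 := Subseq.translate_of_jointLimit hG hθ (a := -(b + M)) (b := -c) (c := -b) (y := -a)
    (by linarith) (by linarith) (by linarith) b
  rw [show -(b + M) + b = -M by ring, show -c + b = -(c - b) by ring,
    show -b + b = (0 : ℝ) by ring, show -a + b = b - a by ring] at h2
  exact h2.trans h1

/-- **Straightening the third mark**: if the wired values `G(−M, −σ, 1/M, x)` converge to `W` as
`M → ∞` (`σ, x > 0`), so do the values `G(−M, −σ, 0, x)`: lowering the third mark from `1/M` to `0`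
grows the target arc and costs at most `4C(8(1/M)/σ)^α → 0` by the `δ`-move bound. [folklore] -/
theorem threeArc_tendsto_wired_zero (hθ : StrictMono θ) {σ x W : ℝ} (hσ : 0 < σ) (hx : 0 < x)
    (hW : Tendsto (fun M : ℕ ↦ G (-(M : ℝ)) (-σ) ((M : ℝ)⁻¹) x) atTop (𝓝 W)) :
    Tendsto (fun M : ℕ ↦ G (-(M : ℝ)) (-σ) 0 x) atTop (𝓝 W) := by
  obtain ⟨C, α, hC0, hα, hesc⟩ := exists_real_boxToFar_le_rpow_of_le_half
  -- the move error `4C(8(1/M)/σ)^α → 0`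
  have herr : Tendsto (fun M : ℕ ↦ 4 * (C * (8 * (M : ℝ)⁻¹ / (0 - -σ)) ^ α)) atTop (𝓝 0) := by
    have h1 : Tendsto (fun M : ℕ ↦ 8 * (M : ℝ)⁻¹ / (0 - -σ)) atTop (𝓝 (8 * 0 / (0 - -σ))) :=
      ((tendsto_inv_atTop_nhds_zero_nat (𝕜 := ℝ)).const_mul 8).div_const _
    rw [mul_zero, zero_div] at h1
    have h2 := ((h1.rpow_const_nhds_zero hα).const_mul C).const_mul 4
    simpa only [mul_zero] using h2
  have hup : Tendsto (fun M : ℕ ↦ G (-(M : ℝ)) (-σ) ((M : ℝ)⁻¹) x +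
      4 * (C * (8 * (M : ℝ)⁻¹ / (0 - -σ)) ^ α)) atTop (𝓝 W) := by
    simpa only [add_zero] using hW.add herr
  -- large `M`: the chamber inequalities and the gap condition `10/M ≤ σ`
  have e1 : ∀ᶠ M : ℕ in atTop, max (max σ x⁻¹) (10 / σ) < (M : ℝ) :=
    (tendsto_natCast_atTop_atTop (R := ℝ)).eventually_gt_atTop _
  refine tendsto_of_tendsto_of_tendsto_of_le_of_le' hW hup ?_ ?_
  · filter_upwards [e1] with M hM
    have hMσ : σ < M := lt_of_le_of_lt ((le_max_left _ _).trans (le_max_left _ _)) hM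
    have hM0 : (0 : ℝ) < M := hσ.trans hMσ
    have hMi : (0 : ℝ) < (M : ℝ)⁻¹ := inv_pos.2 hM0
    have hMx : (M : ℝ)⁻¹ < x :=
      (inv_lt_comm₀ hx hM0).1 (lt_of_le_of_lt ((le_max_right _ _).trans (le_max_left _ _)) hM)
    exact Subseq.jointLimit_mono hG le_rfl le_rfl hMi.le le_rfl (by linarith) (by linarith) hMx
      (by linarith)
  · filter_upwards [e1] with M hM
    have hMσ : σ < M := lt_of_le_of_lt ((le_max_left _ _).trans (le_max_left _ _)) hM
    have hM0 : (0 : ℝ) < M := hσ.trans hMσ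
    have hMi : (0 : ℝ) < (M : ℝ)⁻¹ := inv_pos.2 hM0
    have hMx : (M : ℝ)⁻¹ < x :=
      (inv_lt_comm₀ hx hM0).1 (lt_of_le_of_lt ((le_max_right _ _).trans (le_max_left _ _)) hM)
    have hM10 : 10 / σ < M := lt_of_le_of_lt (le_max_right _ _) hM
    have hgap : 10 * (M : ℝ)⁻¹ ≤ 0 - -σ := by
      rw [sub_neg_eq_add, zero_add, ← div_eq_mul_inv, div_le_iff₀ hM0, mul_comm]
      exact ((div_lt_iff₀ hσ).1 hM10).le
    exact Subseq.jointLimit_move_le hG hθ hC0.le hα hesc le_rfl le_rfl hMi.le le_rfl (by linarith)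
      (by linarith) hMx (by linarith) hMi (by linarith) (by linarith) (by linarith) (by linarith)
      hgap

end Limit

/-- STUB T1' (glue): W1 gives T1 — for a joint subsequential limit `G` along a strictly increasing
`θ` and `a < b < c`, the three-arc limit `lim_{y→∞} G(a,b,c,y)` exists (monotone convergence in the
fourth mark) and equals the wired limit `W_G(c−b, b−a) = lim_M G(−M, −(c−b), 1/M, b−a)` of (W1)
(reflection + translation turn `G(a,b,c,b+M)` into `G(−M,−(c−b),0,b−a)`, and the `δ`-move bound
straightens the third mark `0 ↝ 1/M`). [folklore] -/
theorem stub_threeArc_limit_of :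
    (∀ {θ : ℕ → ℕ} {G : ℝ → ℝ → ℝ → ℝ → ℝ}, (∀ a b c y : ℝ, a < b → b < c → c < y → Tendsto (fun n ↦ μ.real (openCrossing halfPlane (arcA a b (θ n)) (rowIcc ⌊c * (θ n : ℕ)⌋ ⌊y * (θ n : ℕ)⌋))) atTop (𝓝 (G a b c y))) → StrictMono θ → ∀ σ x : ℝ, 0 < σ → 0 < x → ∃ W : ℝ, Tendsto (fun M : ℕ ↦ G (-(M : ℝ)) (-σ) ((M : ℝ)⁻¹) x) atTop (𝓝 W) ∧ Tendsto (fun n ↦ μ.real (openCrossing halfPlane {v : Site 2 | v 1 = 0 ∧ v 0 ≤ -⌊σ * (θ n : ℕ)⌋} {v : Site 2 | v 1 = 0 ∧ 1 ≤ v 0 ∧ v 0 ≤ ⌊x * (θ n : ℕ)⌋})) atTop (𝓝 W)) →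
    ∀ {θ : ℕ → ℕ} {G : ℝ → ℝ → ℝ → ℝ → ℝ},
      (∀ a b c y : ℝ, a < b → b < c → c < y →
        Tendsto (fun n ↦ μ.real (openCrossing halfPlane (arcA a b (θ n))
          (rowIcc ⌊c * (θ n : ℕ)⌋ ⌊y * (θ n : ℕ)⌋))) atTop (𝓝 (G a b c y))) →
      StrictMono θ → ∀ a b c : ℝ, a < b → b < c → ∃ L : ℝ,
        Tendsto (fun y : ℝ ↦ G a b c y) atTop (𝓝 L) ∧
        Tendsto (fun M : ℕ ↦ G (-(M : ℝ)) (-(c - b)) ((M : ℝ)⁻¹) (b - a)) atTop (𝓝 L) := by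
  intro hW1 θ G hG hθ a b c hab hbc
  have hσ : 0 < c - b := sub_pos.2 hbc
  have hx : 0 < b - a := sub_pos.2 hab
  -- (W1) at `(σ, x) = (c − b, b − a)`: the wired values converge, to `W`
  obtain ⟨W, hW, -⟩ := hW1 hG hθ (c - b) (b - a) hσ hx
  refine ⟨W, ?_, hW⟩
  -- (1) the monotone limit in the fourth mark
  have h1 := threeArc_tendsto_ciSup hG hab hbc
  -- (2) along `y = b + M` it is the limit of `G(−M, −σ, 0, x)`
  have h2 : Tendsto (fun M : ℕ ↦ G (-(M : ℝ)) (-(c - b)) 0 (b - a)) atTop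
      (𝓝 (⨆ t : ℝ, G a b c (max t (c + 1)))) := by
    refine (h1.comp (tendsto_atTop_add_const_left atTop b
      (tendsto_natCast_atTop_atTop (R := ℝ)))).congr' ?_
    filter_upwards [(tendsto_natCast_atTop_atTop (R := ℝ)).eventually_gt_atTop (c - b)] with M hM
    exact (threeArc_reflect_translate hG hθ hab hbc hM).symm
  -- (3) which is the wired limit `W` (straightening the third mark), by uniqueness of limits
  have h3 := threeArc_tendsto_wired_zero hG hθ hσ hx hW
  rwa [tendsto_nhds_unique h2 h3] at h1

end WiredDual

end Summit.CriticalPhenomena.CardyFormulaZ2.Cruxes.HalfPlaneMarkDensityLaw.SketchLine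

end
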